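import Summits.ValiantsHypothesis.ValiantsHypothesis.Theorems.BarrierLeverAnchoredDoorHitsLowerPairsXElimRow
import Summits.ValiantsHypothesis.ValiantsHypothesis.Theorems.BarrierLeverAnchoredDoorHitsLowerPairsStarSpec

/-!
# Support item `AnchoredDoorHitsLowerPairs` (stmt-ValiantsHypothesis-22510), line `anchored-peeling`:
# THE X-ELIMINATION STEP — dominance-ordered items, the top `λ`-coefficient of the determinant is `det TOP · det BOT`
# (part 3 of the x-elimination recursion for Conjecture Z)

Helper file (`--supports stmt-ValiantsHypothesis-22510`; cell valiant-natproofs, rung V4, 𝒟-side door (c); registered line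
`Cruxes/AnchoredDoorHitsLowerPairs/Lines/anchored_peeling.lean` v26; node `Stmt.stub_conjZ` (p695484); prover seat val-np-p1 gen 26; memo
HOME/val-np-p1/g26/MEMO-conjZ-node-valnp1-g26.md §4, lab/xcert2.py). Closes NO item. Sequel of `…XElimDefs` / `…XElimSplit` / `…XElimRow`.

THE STEP (memo g26 §4). Fix a variable `a`, base parameters `(Θ⁰, Φ⁰, Ψ⁰)`, a set `IB` of BLOCK ITEMS and a set `IL` of LABEL ITEMS with exponents `eB`, `eL`.
At the level parameters with weights `cB B = λ^{eB B}` (`B ∈ IB`), `cL ℓ = λ^{eL ℓ}` (`ℓ ∈ IL`), a row `U ∌ a` reads the base entries (`entry_lv_of_notMem`) and a row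
`U' + a` reads `Σ_{ℓ ∈ L ∩ IL} λ^{eL ℓ} e(U'; L, W) + Σ_{B ∈ blocks W ∩ IB} λ^{eB B} e(U'; L + ({a}|B), W \ B)` (`entry_lv_insert`). Take TOP data — rows `u₀`
avoiding `a` against UNTOUCHED columns `κ₀` (no item touches them) — and BOTTOM data — link rows `u₁` (`a ∉ u₁ i`, read through `insert a`) against TOUCHED columns
`κ₁` whose item of LARGEST exponent `d j ≥ 1` is unique, with CAPTURE `cap j` (the column itself for a label item, `(L + ({a}|B₀), W \ B₀)` for a block item
`B₀`). Then the `λ`-polynomial determinant of the whole layout has, at degree `Σ_j d j`, the coefficient `det TOP · det BOT` (`coeff_det_of_natDegree_le` on the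
block-triangular top-coefficient matrix), so:

**`exists_det_ne_zero_step`.** If `det [e⁰(u₀ i; κ₀ j)] ≠ 0` and `det [e⁰(u₁ i; cap j)] ≠ 0` for the SAME base parameters, then some parameters make the labelled
matrix of the combined enumeration (rows `u₀` then `insert a ∘ u₁`, columns `κ₀` then `κ₁`) nonsingular.

WHAT THIS IS NOT: the recursion / certificate format is the sequel; nothing on crux stmt-ValiantsHypothesis-14610 or on `VP` versus `VNP`.
-/

set_option linter.dupNamespace false

namespace Summit.ValiantsHypothesis.ValiantsHypothesis.Theorems.BarrierLever.AnchoredPeeling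

open Finset MvPolynomial
open Summit.ValiantsHypothesis.ValiantsHypothesis.Theorems.BarrierLever.BrickCalculus (pexpo pexpo_def pexpo_le_iff pexpo_sub
  pexpo_apply_castAdd pexpo_apply_natAdd)

noncomputable section

namespace XElim

variable {h : ℕ}

/-! ## 1. Items, captures, untouched and touched columns -/

section Items

variable (a : Fin h) (IB : Finset (Finset (Fin h))) (IL : Finset (Anchor h)) (eB : Finset (Fin h) → ℕ) (eL : Anchor h → ℕ)

/-- The capture of the column `c = (L, W)` by the block item `B`: `(L + ({a}|B), W \ B)`. -/
def capB (B : Finset (Fin h)) (c : LCol h) : LCol h := (insert (({a} : Finset (Fin h)), B) c.1, c.2 \ B)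

/-- A column is UNTOUCHED if no label item is among its labels and no block item is among its blocks. -/
def Untouched (c : LCol h) : Prop := (∀ ℓ ∈ c.1, ℓ ∉ IL) ∧ (∀ B ∈ blocks c.2, B ∉ IB)

/-- `IsTop c d c'`: the items touching `c` have exponents `≤ d`, `d ≥ 1`, EXACTLY ONE of them has exponent `d`, and `c'` is the corresponding capture
(the column itself for a label item, `capB a B₀ c` for a block item `B₀`). -/
def IsTop (c : LCol h) (d : ℕ) (c' : LCol h) : Prop :=
  1 ≤ d ∧ (∀ ℓ ∈ c.1, ℓ ∈ IL → eL ℓ ≤ d) ∧ (∀ B ∈ blocks c.2, B ∈ IB → eB B ≤ d) ∧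
  (((c.1.filter (fun ℓ => ℓ ∈ IL ∧ eL ℓ = d)).card = 1 ∧ (∀ B ∈ blocks c.2, B ∈ IB → eB B ≠ d) ∧ c' = c) ∨
   ((c.1.filter (fun ℓ => ℓ ∈ IL ∧ eL ℓ = d)).card = 0 ∧
     ∃ B₀ ∈ blocks c.2, B₀ ∈ IB ∧ eB B₀ = d ∧ (∀ B ∈ blocks c.2, B ∈ IB → eB B = d → B = B₀) ∧ c' = capB a B₀ c))

/-- The level weights at the scale value `t`: `cB B = t^{eB B}` on block items, `0` elsewhere. -/
def cBt (t : ℂ) : Finset (Fin h) → ℂ := fun B => if B ∈ IB then t ^ eB B else 0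

/-- The level label weights at `t`: `cL ℓ = t^{eL ℓ}` on label items, `0` elsewhere. -/
def cLt (t : ℂ) : Anchor h → ℂ := fun ℓ => if ℓ ∈ IL then t ^ eL ℓ else 0

end Items

/-! ## 2. The `λ`-polynomial entries of a row through `a` -/

section Poly

variable (a : Fin h) (IB : Finset (Finset (Fin h))) (IL : Finset (Anchor h)) (eB : Finset (Fin h) → ℕ) (eL : Anchor h → ℕ)
  (Θ₀ : Anchor h → ℂ) (Φ₀ Ψ₀ : Anchor h → Fin h → ℂ)

/-- The polynomial entry of the column `c` on the link row `U'` (to be read on `insert a U'`):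
`Σ_{ℓ ∈ L ∩ IL} e⁰(U'; c) λ^{eL ℓ} + Σ_{B ∈ blocks W ∩ IB} e⁰(U'; capB B c) λ^{eB B}`. -/
def pEntry (U' : Finset (Fin h)) (c : LCol h) : Polynomial ℂ :=
  ∑ ℓ ∈ c.1.filter (fun ℓ => ℓ ∈ IL), Polynomial.C (entry Θ₀ Φ₀ Ψ₀ U' c) * Polynomial.X ^ eL ℓ +
  ∑ B ∈ (blocks c.2).filter (fun B => B ∈ IB), Polynomial.C (entry Θ₀ Φ₀ Ψ₀ U' (capB a B c)) * Polynomial.X ^ eB B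

/-- **Evaluating the polynomial entry at `t` gives the level entry through `a`.** -/
theorem eval_pEntry {U' : Finset (Fin h)} (hU' : a ∉ U') (c : LCol h) (hc : ∀ ℓ ∈ c.1, ℓ.1 ≠ {a}) (t : ℂ) :
    (pEntry a IB IL eB eL Θ₀ Φ₀ Ψ₀ U' c).eval t =
      entry (lvTheta a Θ₀ (cBt IB eB t)) (lvPhi a Φ₀ Ψ₀) (lvPsi a Ψ₀ (cLt IL eL t)) (insert a U') c := by
  classical
  obtain ⟨L, W⟩ := c
  rw [entry_lv_insert a Θ₀ Φ₀ Ψ₀ _ _ hU' L W hc, pEntry, Polynomial.eval_add, Polynomial.eval_finsetSum, Polynomial.eval_finsetSum]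
  simp only [Polynomial.eval_mul, Polynomial.eval_C, Polynomial.eval_pow, Polynomial.eval_X]
  congr 1
  · rw [Finset.sum_filter, Finset.sum_mul]
    refine Finset.sum_congr rfl (fun ℓ _ => ?_)
    rw [entry_lv_of_notMem a Θ₀ Φ₀ Ψ₀ _ _ hU', cLt]
    split_ifs <;> ring
  · rw [Finset.sum_filter]
    refine Finset.sum_congr rfl (fun B _ => ?_)
    rw [entry_lv_of_notMem a Θ₀ Φ₀ Ψ₀ _ _ hU', cBt, capB]
    split_ifs <;> ring

/-- An untouched column has zero polynomial entry. -/
theorem pEntry_eq_zero_of_untouched (U' : Finset (Fin h)) {c : LCol h} (hc : Untouched IB IL c) : pEntry a IB IL eB eL Θ₀ Φ₀ Ψ₀ U' c = 0 := by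
  classical
  rw [pEntry]
  have h1 : c.1.filter (fun ℓ => ℓ ∈ IL) = ∅ := Finset.filter_eq_empty_iff.mpr (fun ℓ hℓ => hc.1 ℓ hℓ)
  have h2 : (blocks c.2).filter (fun B => B ∈ IB) = ∅ := Finset.filter_eq_empty_iff.mpr (fun B hB => hc.2 B hB)
  rw [h1, h2, Finset.sum_empty, Finset.sum_empty, add_zero]

/-- Degree bound of the polynomial entry of a touched column. -/
theorem natDegree_pEntry_le (U' : Finset (Fin h)) {c : LCol h} {d : ℕ} {c' : LCol h} (hc : IsTop a IB IL eB eL c d c') :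
    (pEntry a IB IL eB eL Θ₀ Φ₀ Ψ₀ U' c).natDegree ≤ d := by
  classical
  obtain ⟨_, hL, hB, _⟩ := hc
  rw [pEntry]
  refine (Polynomial.natDegree_add_le _ _).trans (max_le ?_ ?_)
  · refine Polynomial.natDegree_sum_le_of_forall_le _ _ (fun ℓ hℓ => ?_)
    obtain ⟨hℓ1, hℓ2⟩ := Finset.mem_filter.mp hℓ
    exact (Polynomial.natDegree_C_mul_X_pow_le _ _).trans (hL ℓ hℓ1 hℓ2)
  · refine Polynomial.natDegree_sum_le_of_forall_le _ _ (fun B hB' => ?_)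
    obtain ⟨hB1, hB2⟩ := Finset.mem_filter.mp hB'
    exact (Polynomial.natDegree_C_mul_X_pow_le _ _).trans (hB B hB1 hB2)

/-- **Top coefficient of the polynomial entry of a touched column: the base entry of its capture.** -/
theorem coeff_pEntry_top (U' : Finset (Fin h)) {c : LCol h} {d : ℕ} {c' : LCol h} (hc : IsTop a IB IL eB eL c d c') :
    (pEntry a IB IL eB eL Θ₀ Φ₀ Ψ₀ U' c).coeff d = entry Θ₀ Φ₀ Ψ₀ U' c' := by
  classical
  obtain ⟨_, _, _, hcase⟩ := hc
  rw [pEntry, Polynomial.coeff_add, Polynomial.finsetSum_coeff, Polynomial.finsetSum_coeff]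
  simp only [Polynomial.coeff_C_mul_X_pow]
  -- label part: a constant times the number of label items of exponent `d`
  have hlab : (∑ ℓ ∈ c.1.filter (fun ℓ => ℓ ∈ IL), if d = eL ℓ then entry Θ₀ Φ₀ Ψ₀ U' c else 0) =
      ((c.1.filter (fun ℓ => ℓ ∈ IL ∧ eL ℓ = d)).card : ℂ) * entry Θ₀ Φ₀ Ψ₀ U' c := by
    rw [← Finset.sum_filter, Finset.filter_filter, Finset.sum_const, nsmul_eq_mul,
      Finset.filter_congr (fun ℓ _ => show (ℓ ∈ IL ∧ d = eL ℓ) ↔ (ℓ ∈ IL ∧ eL ℓ = d) from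
        ⟨fun h' => ⟨h'.1, h'.2.symm⟩, fun h' => ⟨h'.1, h'.2.symm⟩⟩)]
  rw [hlab]
  rcases hcase with ⟨hcard, hnoB, rfl⟩ | ⟨hcard, B₀, hB₀, hB₀I, hB₀d, huniq, rfl⟩
  · rw [hcard, Nat.cast_one, one_mul]
    rw [Finset.sum_eq_zero (fun B hB => ?_), add_zero]
    obtain ⟨hB1, hB2⟩ := Finset.mem_filter.mp hB
    rw [if_neg (fun heq => hnoB B hB1 hB2 heq.symm)]
  · rw [hcard, Nat.cast_zero, zero_mul, zero_add]
    rw [Finset.sum_eq_single_of_mem B₀ (Finset.mem_filter.mpr ⟨hB₀, hB₀I⟩) (fun B hB hne => ?_), if_pos hB₀d.symm]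
    obtain ⟨hB1, hB2⟩ := Finset.mem_filter.mp hB
    rw [if_neg (fun heq => hne (huniq B hB1 hB2 heq.symm))]

end Poly

/-! ## 3. The polynomial layout matrix and its top coefficient -/

section StepMatrix

variable (a : Fin h) (IB : Finset (Finset (Fin h))) (IL : Finset (Anchor h)) (eB : Finset (Fin h) → ℕ) (eL : Anchor h → ℕ)
  (Θ₀ : Anchor h → ℂ) (Φ₀ Ψ₀ : Anchor h → Fin h → ℂ)
  {n₀ n₁ : ℕ} (u₀ : Fin n₀ → Finset (Fin h)) (κ₀ : Fin n₀ → LCol h) (u₁ : Fin n₁ → Finset (Fin h)) (κ₁ cap : Fin n₁ → LCol h) (d : Fin n₁ → ℕ)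

/-- The `λ`-polynomial layout matrix: rows `u₀` (avoiding `a`) then `insert a ∘ u₁`, columns `κ₀` (untouched) then `κ₁` (touched). -/
def stepMat : Matrix (Fin n₀ ⊕ Fin n₁) (Fin n₀ ⊕ Fin n₁) (Polynomial ℂ) :=
  Matrix.of fun p q => match p, q with
    | Sum.inl i, Sum.inl j => Polynomial.C (entry Θ₀ Φ₀ Ψ₀ (u₀ i) (κ₀ j))
    | Sum.inl i, Sum.inr j => Polynomial.C (entry Θ₀ Φ₀ Ψ₀ (u₀ i) (κ₁ j))
    | Sum.inr _, Sum.inl _ => 0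
    | Sum.inr i, Sum.inr j => pEntry a IB IL eB eL Θ₀ Φ₀ Ψ₀ (u₁ i) (κ₁ j)

/-- The combined row enumeration on the sum type. -/
def rowsS : Fin n₀ ⊕ Fin n₁ → Finset (Fin h) := Sum.elim u₀ (fun i => insert a (u₁ i))

/-- The combined column enumeration on the sum type. -/
def colsS : Fin n₀ ⊕ Fin n₁ → LCol h := Sum.elim κ₀ κ₁

/-- The column degree bounds: `0` on untouched columns, `d j` on touched ones. -/
def degS : Fin n₀ ⊕ Fin n₁ → ℕ := Sum.elim (fun _ => 0) d

variable {a IB IL eB eL Θ₀ Φ₀ Ψ₀ u₀ κ₀ u₁ κ₁ cap d}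

/-- **Evaluating the polynomial layout at `t` gives the level layout.** -/
theorem eval_stepMat (hu₀ : ∀ i, a ∉ u₀ i) (hu₁ : ∀ i, a ∉ u₁ i) (hunt : ∀ j, Untouched IB IL (κ₀ j))
    (hlab₀ : ∀ j, ∀ ℓ ∈ (κ₀ j).1, ℓ.1 ≠ {a}) (hlab₁ : ∀ j, ∀ ℓ ∈ (κ₁ j).1, ℓ.1 ≠ {a}) (t : ℂ) (p q : Fin n₀ ⊕ Fin n₁) :
    (stepMat a IB IL eB eL Θ₀ Φ₀ Ψ₀ u₀ κ₀ u₁ κ₁ p q).eval t =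
      entry (lvTheta a Θ₀ (cBt IB eB t)) (lvPhi a Φ₀ Ψ₀) (lvPsi a Ψ₀ (cLt IL eL t)) (rowsS a u₀ u₁ p) (colsS κ₀ κ₁ q) := by
  rcases p with i | i <;> rcases q with j | j
  · rw [stepMat, Matrix.of_apply, rowsS, colsS, Sum.elim_inl, Sum.elim_inl, Polynomial.eval_C, entry_lv_of_notMem a Θ₀ Φ₀ Ψ₀ _ _ (hu₀ i)]
  · rw [stepMat, Matrix.of_apply, rowsS, colsS, Sum.elim_inl, Sum.elim_inr, Polynomial.eval_C, entry_lv_of_notMem a Θ₀ Φ₀ Ψ₀ _ _ (hu₀ i)]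
  · -- an untouched column reads `0` through `a`
    rw [stepMat, Matrix.of_apply, rowsS, colsS, Sum.elim_inr, Sum.elim_inl, Polynomial.eval_zero,
      ← eval_pEntry a IB IL eB eL Θ₀ Φ₀ Ψ₀ (hu₁ i) (κ₀ j) (hlab₀ j) t, pEntry_eq_zero_of_untouched a IB IL eB eL Θ₀ Φ₀ Ψ₀ _ (hunt j),
      Polynomial.eval_zero]
  · rw [stepMat, Matrix.of_apply, rowsS, colsS, Sum.elim_inr, Sum.elim_inr, eval_pEntry a IB IL eB eL Θ₀ Φ₀ Ψ₀ (hu₁ i) (κ₁ j) (hlab₁ j) t]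

/-- Degree bounds of the polynomial layout, column by column. -/
theorem natDegree_stepMat_le (htop : ∀ j, IsTop a IB IL eB eL (κ₁ j) (d j) (cap j)) (p q : Fin n₀ ⊕ Fin n₁) :
    (stepMat a IB IL eB eL Θ₀ Φ₀ Ψ₀ u₀ κ₀ u₁ κ₁ p q).natDegree ≤ degS d q := by
  rcases p with i | i <;> rcases q with j | j
  · rw [stepMat, Matrix.of_apply, degS, Sum.elim_inl, Polynomial.natDegree_C]
  · rw [stepMat, Matrix.of_apply, degS, Sum.elim_inr, Polynomial.natDegree_C]; exact Nat.zero_le _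
  · rw [stepMat, Matrix.of_apply, degS, Sum.elim_inl, Polynomial.natDegree_zero]
  · rw [stepMat, Matrix.of_apply, degS, Sum.elim_inr]; exact natDegree_pEntry_le a IB IL eB eL Θ₀ Φ₀ Ψ₀ _ (htop j)

/-- **The top-coefficient matrix is block diagonal: TOP base entries, and the base entries of the captures.** -/
theorem coeff_stepMat_top (htop : ∀ j, IsTop a IB IL eB eL (κ₁ j) (d j) (cap j)) :
    (Matrix.of fun p q => (stepMat a IB IL eB eL Θ₀ Φ₀ Ψ₀ u₀ κ₀ u₁ κ₁ p q).coeff (degS d q)) =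
      Matrix.fromBlocks (lmat Θ₀ Φ₀ Ψ₀ u₀ κ₀) 0 0 (lmat Θ₀ Φ₀ Ψ₀ u₁ cap) := by
  ext p q
  rcases p with i | i <;> rcases q with j | j
  · rw [Matrix.of_apply, Matrix.fromBlocks_apply₁₁, stepMat, Matrix.of_apply, degS, Sum.elim_inl, Polynomial.coeff_C_zero, lmat, Matrix.of_apply]
  · rw [Matrix.of_apply, Matrix.fromBlocks_apply₁₂, stepMat, Matrix.of_apply, degS, Sum.elim_inr, Polynomial.coeff_C, Matrix.zero_apply,
      if_neg (by have := (htop j).1; omega)]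
  · rw [Matrix.of_apply, Matrix.fromBlocks_apply₂₁, stepMat, Matrix.of_apply, Polynomial.coeff_zero, Matrix.zero_apply]
  · rw [Matrix.of_apply, Matrix.fromBlocks_apply₂₂, stepMat, Matrix.of_apply, degS, Sum.elim_inr, lmat, Matrix.of_apply,
      coeff_pEntry_top a IB IL eB eL Θ₀ Φ₀ Ψ₀ _ (htop j)]

/-- **The top coefficient of the determinant is `det TOP · det BOT`.** -/
theorem coeff_det_stepMat (htop : ∀ j, IsTop a IB IL eB eL (κ₁ j) (d j) (cap j)) :
    (stepMat a IB IL eB eL Θ₀ Φ₀ Ψ₀ u₀ κ₀ u₁ κ₁).det.coeff (∑ q : Fin n₀ ⊕ Fin n₁, degS d q) = (lmat Θ₀ Φ₀ Ψ₀ u₀ κ₀).det * (lmat Θ₀ Φ₀ Ψ₀ u₁ cap).det := by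
  rw [coeff_det_of_natDegree_le (stepMat a IB IL eB eL Θ₀ Φ₀ Ψ₀ u₀ κ₀ u₁ κ₁) (degS d) (natDegree_stepMat_le htop), coeff_stepMat_top htop,
    Matrix.det_fromBlocks_zero₂₁]

end StepMatrix

/-! ## 4. The step: from TOP and BOT to the whole layout -/

section Step

variable {a : Fin h} {IB : Finset (Finset (Fin h))} {IL : Finset (Anchor h)} {eB : Finset (Fin h) → ℕ} {eL : Anchor h → ℕ}
  {Θ₀ : Anchor h → ℂ} {Φ₀ Ψ₀ : Anchor h → Fin h → ℂ}
  {n₀ n₁ : ℕ} {u₀ : Fin n₀ → Finset (Fin h)} {κ₀ : Fin n₀ → LCol h} {u₁ : Fin n₁ → Finset (Fin h)} {κ₁ cap : Fin n₁ → LCol h} {d : Fin n₁ → ℕ}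

/-- The combined row enumeration `Fin (n₀ + n₁) → faces`: `u₀`, then `insert a ∘ u₁`. -/
def rowsF (a : Fin h) (u₀ : Fin n₀ → Finset (Fin h)) (u₁ : Fin n₁ → Finset (Fin h)) : Fin (n₀ + n₁) → Finset (Fin h) :=
  fun k => rowsS a u₀ u₁ (finSumFinEquiv.symm k)

/-- The combined column enumeration `Fin (n₀ + n₁) → columns`: `κ₀`, then `κ₁`. -/
def colsF (κ₀ : Fin n₀ → LCol h) (κ₁ : Fin n₁ → LCol h) : Fin (n₀ + n₁) → LCol h :=
  fun k => colsS κ₀ κ₁ (finSumFinEquiv.symm k)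

/-- **THE X-ELIMINATION STEP.** TOP nonsingular and BOT nonsingular at common base parameters ⟹ the combined layout is nonsingular for some parameters
(namely the level parameters at a suitable scale value `t`). -/
theorem exists_det_ne_zero_step (hu₀ : ∀ i, a ∉ u₀ i) (hu₁ : ∀ i, a ∉ u₁ i) (hunt : ∀ j, Untouched IB IL (κ₀ j))
    (htop : ∀ j, IsTop a IB IL eB eL (κ₁ j) (d j) (cap j))
    (hlab₀ : ∀ j, ∀ ℓ ∈ (κ₀ j).1, ℓ.1 ≠ {a}) (hlab₁ : ∀ j, ∀ ℓ ∈ (κ₁ j).1, ℓ.1 ≠ {a})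
    (h0 : (lmat Θ₀ Φ₀ Ψ₀ u₀ κ₀).det ≠ 0) (h1 : (lmat Θ₀ Φ₀ Ψ₀ u₁ cap).det ≠ 0) :
    ∃ (Θ : Anchor h → ℂ) (Φ Ψ : Anchor h → Fin h → ℂ), (lmat Θ Φ Ψ (rowsF a u₀ u₁) (colsF κ₀ κ₁)).det ≠ 0 := by
  classical
  set M := stepMat a IB IL eB eL Θ₀ Φ₀ Ψ₀ u₀ κ₀ u₁ κ₁ with hM
  -- the determinant polynomial is nonzero: its top coefficient is `det TOP · det BOT`
  have hdet : M.det ≠ 0 := by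
    intro h0'
    have hc := coeff_det_stepMat (u₀ := u₀) (κ₀ := κ₀) (u₁ := u₁) (Θ₀ := Θ₀) (Φ₀ := Φ₀) (Ψ₀ := Ψ₀) htop
    rw [← hM, h0', Polynomial.coeff_zero] at hc
    exact mul_ne_zero h0 h1 hc.symm
  -- hence it has a non-root `t`
  have ht : ∃ t : ℂ, M.det.eval t ≠ 0 := by
    by_contra hall
    push Not at hall
    exact hdet (Polynomial.funext (fun t => by rw [hall t, Polynomial.eval_zero]))
  obtain ⟨t, ht⟩ := ht
  refine ⟨lvTheta a Θ₀ (cBt IB eB t), lvPhi a Φ₀ Ψ₀, lvPsi a Ψ₀ (cLt IL eL t), ?_⟩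
  -- the evaluated matrix is the level layout on the sum type, reindexed to `Fin (n₀ + n₁)`
  have heval : M.map (Polynomial.eval t) =
      Matrix.of (fun p q => entry (lvTheta a Θ₀ (cBt IB eB t)) (lvPhi a Φ₀ Ψ₀) (lvPsi a Ψ₀ (cLt IL eL t)) (rowsS a u₀ u₁ p) (colsS κ₀ κ₁ q)) := by
    ext p q
    rw [Matrix.map_apply, Matrix.of_apply, hM, eval_stepMat hu₀ hu₁ hunt hlab₀ hlab₁ t p q]
  have hdet' : (Matrix.of (fun p q => entry (lvTheta a Θ₀ (cBt IB eB t)) (lvPhi a Φ₀ Ψ₀) (lvPsi a Ψ₀ (cLt IL eL t))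
      (rowsS a u₀ u₁ p) (colsS κ₀ κ₁ q))).det ≠ 0 := by
    rw [← heval]
    have : (M.map (Polynomial.eval t)).det = (Polynomial.evalRingHom t) M.det := by
      rw [RingHom.map_det]; rfl
    rw [this]
    exact ht
  have hsub : lmat (lvTheta a Θ₀ (cBt IB eB t)) (lvPhi a Φ₀ Ψ₀) (lvPsi a Ψ₀ (cLt IL eL t)) (rowsF a u₀ u₁) (colsF κ₀ κ₁) =
      (Matrix.of (fun p q => entry (lvTheta a Θ₀ (cBt IB eB t)) (lvPhi a Φ₀ Ψ₀) (lvPsi a Ψ₀ (cLt IL eL t))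
        (rowsS a u₀ u₁ p) (colsS κ₀ κ₁ q))).submatrix finSumFinEquiv.symm finSumFinEquiv.symm := by
    ext k k'
    rw [lmat, Matrix.of_apply, Matrix.submatrix_apply, Matrix.of_apply, rowsF, colsF]
  rw [hsub, Matrix.det_submatrix_equiv_self]
  exact hdet'

end Step

end XElim

end

end Summit.ValiantsHypothesis.ValiantsHypothesis.Theorems.BarrierLever.AnchoredPeeling
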